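import Summits.CriticalPhenomena.PercolationContinuityZ3.Theses.PercAnnulusCrossing
import Summits.CriticalPhenomena.PercolationContinuityZ3.Theorems.PercTiltedBlockersWideBoxFromTilt
import Summits.CriticalPhenomena.PercolationContinuityZ3.Theorems.PercNonProliferationSubpolynomialBlockingStubBlockerRSWGlue

/-!
# Line `blocker-tilt-allp` — registered skeleton for the crux `CritAnnulusNonCrossing`
# (stmt-CriticalPhenomena-0846, route `PercAnnulusCrossing`, rank 2) THROUGH its BC2 redirect
# `CritAnnulusNonCrossing ⇐ BlockerRSW3D ∧ CubeBlockingSeed`, and the plan for the piece `BlockerRSW3D`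
# (stmt-CriticalPhenomena-1129, rank 3)

Parent (fixed, by name): `PercAnnulusCrossing.CritAnnulusNonCrossing` (`X_B`: `P_{p_c}(Λ_n ↔ ∂ⁱⁿΛ_{2n}
in Λ_{2n}) ≤ 1 - c`). Its decomposition `X_B ⇐ X₁ ∧ X₂`, `X₁ = BlockerRSW3D`, `X₂ = CubeBlockingSeed`
(stmt-1141), has a LANDED, non-trivial assembly
`Theorems.SubpolynomialBlocking.StubBlockerRSWGlue.critAnnulusNonCrossing_of` (p121157: tiling at aspect 1
+ six-slab Harris–FKG + small-scale positivity); `X₂` has its own registered skeleton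
(`Cruxes/CubeBlockingSeed/Lines/birth.lean`); this file is the plan for `X₁` and, composed with the landed
assembly, a complete line for the parent: stubs `stub_balancingAllP`, `stub_diagonalAllP` (the content of
`X₁`) and `stub_cubeBlockingSeed` (= the sibling item `X₂` BY NAME, discharged when stmt-1141 closes),
compositions `BlockerRSW3D_of` (→ `X₁` by name) and `CritAnnulusNonCrossing_of` (→ the parent by name),
both PROVED.

Piece `X₁` (fixed, by name): `PercAnnulusCrossing.BlockerRSW3D` — the Benjamini–Kalai "RSW for plaquettes in
cubes" comparison, valid at EVERY `p ∈ [0,1]`: ONE monotone `f`, `f > 0` on `(0,∞)`, with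
`f(q_n(p)) ≤ w_n(p)` for all `p`, `n ≥ 1`, where `q_n(p) = P_p(R(n; n, n) sealed)`,
`w_n(p) = P_p(R(n; 2n, 2n) sealed)`, `R(h; L, M) = [0,h] × [0,L] × [0,M] ∩ ℤ³` (`Finset.Icc 0 (h,L,M)`)
and "sealed" = no open path inside the box from the face `{x₀ = 0}` to the face `{x₀ = h}`.

THE LINE (lens `transfer`, from the sibling route `PercTiltedBlockers` one level up, made p-UNIFORM):
the gluing half of RSW is FREE in `ℤ³` at every `p` — the landed `TiltSquaring`
(`Theorems.tiltSquaring_proof`, all `p`): `P_p(R(h; L+δ, M) sealed) ≥ P_p(Tilt_a(R(h;L,M); δ))²`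
for `δ ≤ L`, where `Tilt_a` = no open path inside `R` from `{x₀=0} ∪ {x₁=L, x₀<a}` to
`{x₀=h} ∪ {x₁=δ, x₀≥a}` — so the whole shape comparison collapses to ONE-BOX statements on the
cube-anchored family `𝔉 = {R(n; L, M) : n ≤ L, M ≤ 5n}` with shift `δ = ⌈n/4⌉`
(`4δ ≤ n+3 ∧ n ≤ 4δ`). Exactly as in the registered skeleton of `TiltComparison`
(`Cruxes/TiltComparison/Lines/birth.lean`, at `p_c` on the flat family), the tilt event factors as
`Tilt_a ⊇ High_a ∩ Low_a ∩ Diag_a` (pure logic), Harris–FKG (proved, `harris_fkg_lower`) merges the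
three decreasing events, and the crux follows from the two registered stubs

* `stub_balancingAllP` (OPEN, load-bearing): one monotone `g₁ > 0` on `(0,∞)` such that for every
  `p` and every box of `𝔉` there is a COMMON level `a` with `P_p(High_a) ≥ g₁(P_p(sealed))` and
  `P_p(Low_a) ≥ g₁(P_p(sealed))` (`High_a`: no open path in `R` from `{x₀=0} ∪ {x₁=L, x₀<a}` to
  `{x₀=n}`; `Low_a`: none from `{x₀=0}` to `{x₀=n} ∪ {x₁=δ, x₀≥a}`) — the p-uniform 3-D
  replacement of Tassion's landing-level balancing (arXiv:1410.6773 L2.1);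
* `stub_diagonalAllP`: one monotone `g₂ > 0` on `(0,∞)` with `P_p(Diag_a) ≥ g₂(P_p(sealed))` for
  EVERY level `a` (`Diag_a`: no open path in `R` from `{x₁=L, x₀<a}` to `{x₁=δ, x₀≥a}`); free
  (`g₂ = id`) for `L ≥ n + δ` by the isometry `x₀ ↔ x₁` and sub-box monotonicity, a short-box
  comparison (aspect change `≥ 3/4` in the sealed direction) for `L ∈ [n, n+δ)`;

by the PROVED composition `BlockerRSW3D_of`: `G s := (max (g₁ s) 0)² · max (g₂ s) 0` gives
`G(β) ≤ P_p(Tilt_a)` on `𝔉` (Harris twice); `φ s := G(s)²` gives the squaring step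
`φ(β_p(n; L, M)) ≤ β_p(n; L+δ, M)` (tilt squaring, every `p`); four steps in `L` from the cube,
the swap `x₁ ↔ x₂` (`tilt_real_blocked_swap`, every `p`), four steps in the other direction and
antitonicity of `β` in the cross-section (`2n ≤ n + 4δ`) give `w_n(p) ≥ φ⁸(q_n(p))`; the witness is
`f s := min s (φ⁸ s)` (monotone, `> 0` on `(0,∞)`, and `f ≤ 0 ≤ w` where `q = 0`, i.e. at `p = 1`).

Disproof used: none filed for this crux (`ledger crux ls stmt-CriticalPhenomena-1129`: no workfiles,
2026-08-17; no `Theorems/BlockerRSW3D/Negative/*`). Evidence on the item: refuter crux-attack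
SURVIVES (13 attacks; every fixed `n` true by compactness; necessary witness shape `f(s) = O(s^{4-ε})`
from `p → 1` — honoured: `f ≤ φ⁸`, a high power near `0`). Negatives index: only `not_TiltGluing`
(stmt-6394, refuted-misstated via a non-lattice open pair; repaired `TiltGluingLattice` PROVED and it is
what `tiltSquaring_proof` consumes) is nearby — the stubs speak about `P_p`-probabilities only.
-/

noncomputable section

open MeasureTheory
open Literature.Probability.Percolation Literature.Probability.LatticeModels
open Summit.CriticalPhenomena.PercolationContinuityZ3.Theorems

namespace Summit.CriticalPhenomena.PercolationContinuityZ3.Cruxes.CritAnnulusNonCrossing.BlockerTiltAllP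

/-! ## The two registered stubs: precise `Prop`s `Stubs.stub_*` + sorried theorems `stub_*` -/

namespace Stubs

/-- **Stub `Prop` 1 (`TiltBalancingAllP`, OPEN, load-bearing)** — for every `p` and every box
`R(n; L, M)` of the family `n ≤ L, M ≤ 5n`, shift `δ = ⌈n/4⌉`, a COMMON level `a` at which both
one-sided tilted-blocker events `High_a`, `Low_a` have probability `≥ g(P_p(R sealed))`. -/
def stub_balancingAllP : Prop :=
  ∃ g : ℝ → ℝ, Monotone g ∧ (∀ s, 0 < s → 0 < g s) ∧ ∀ (p : unitInterval) (n δ L M : ℕ), 1 ≤ n →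
    4 * δ ≤ n + 3 → n ≤ 4 * δ → n ≤ L → L ≤ 5 * n → n ≤ M → M ≤ 5 * n → ∃ a : ℕ,
      g ((bondPercolation (zdGraph 3) p).real
          {ω | ¬ ∃ x ∈ Finset.Icc (0 : Site 3) ![(n : ℤ), L, M],
            ∃ y ∈ Finset.Icc (0 : Site 3) ![(n : ℤ), L, M],
              x 0 = 0 ∧ y 0 = n ∧ ω ∈ openConnIn ↑(Finset.Icc (0 : Site 3) ![(n : ℤ), L, M]) x y}) ≤
        (bondPercolation (zdGraph 3) p).real
          {ω | ¬ ∃ x ∈ Finset.Icc (0 : Site 3) ![(n : ℤ), L, M],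
            ∃ y ∈ Finset.Icc (0 : Site 3) ![(n : ℤ), L, M],
              (x 0 = 0 ∨ (x 1 = L ∧ x 0 < a)) ∧ y 0 = n ∧
                ω ∈ openConnIn ↑(Finset.Icc (0 : Site 3) ![(n : ℤ), L, M]) x y} ∧
      g ((bondPercolation (zdGraph 3) p).real
          {ω | ¬ ∃ x ∈ Finset.Icc (0 : Site 3) ![(n : ℤ), L, M],
            ∃ y ∈ Finset.Icc (0 : Site 3) ![(n : ℤ), L, M],
              x 0 = 0 ∧ y 0 = n ∧ ω ∈ openConnIn ↑(Finset.Icc (0 : Site 3) ![(n : ℤ), L, M]) x y}) ≤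
        (bondPercolation (zdGraph 3) p).real
          {ω | ¬ ∃ x ∈ Finset.Icc (0 : Site 3) ![(n : ℤ), L, M],
            ∃ y ∈ Finset.Icc (0 : Site 3) ![(n : ℤ), L, M],
              x 0 = 0 ∧ (y 0 = n ∨ (y 1 = δ ∧ (a : ℤ) ≤ y 0)) ∧
                ω ∈ openConnIn ↑(Finset.Icc (0 : Site 3) ![(n : ℤ), L, M]) x y}

/-- **Stub `Prop` 2 (`TiltDiagonalAllP`)** — for every `p`, every box of the same family and EVERY
level `a`, the diagonal event `Diag_a` (no open path inside the box from `{x₁ = L, x₀ < a}` to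
`{x₁ = δ, x₀ ≥ a}`) has probability `≥ g(P_p(R sealed))`. -/
def stub_diagonalAllP : Prop :=
  ∃ g : ℝ → ℝ, Monotone g ∧ (∀ s, 0 < s → 0 < g s) ∧ ∀ (p : unitInterval) (n δ L M a : ℕ), 1 ≤ n →
    4 * δ ≤ n + 3 → n ≤ 4 * δ → n ≤ L → L ≤ 5 * n → n ≤ M → M ≤ 5 * n →
      g ((bondPercolation (zdGraph 3) p).real
          {ω | ¬ ∃ x ∈ Finset.Icc (0 : Site 3) ![(n : ℤ), L, M],
            ∃ y ∈ Finset.Icc (0 : Site 3) ![(n : ℤ), L, M],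
              x 0 = 0 ∧ y 0 = n ∧ ω ∈ openConnIn ↑(Finset.Icc (0 : Site 3) ![(n : ℤ), L, M]) x y}) ≤
        (bondPercolation (zdGraph 3) p).real
          {ω | ¬ ∃ x ∈ Finset.Icc (0 : Site 3) ![(n : ℤ), L, M],
            ∃ y ∈ Finset.Icc (0 : Site 3) ![(n : ℤ), L, M],
              (x 1 = L ∧ x 0 < a) ∧ (y 1 = δ ∧ (a : ℤ) ≤ y 0) ∧
                ω ∈ openConnIn ↑(Finset.Icc (0 : Site 3) ![(n : ℤ), L, M]) x y}

end Stubs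

/-- **stub 1 (registered) = `Stubs.stub_balancingAllP` spelled out** — `TiltBalancingAllP`: one
monotone `g > 0` on `(0,∞)` such that for every `p ∈ [0,1]` and every box `R(n; L, M)`,
`n ≤ L, M ≤ 5n`, shift `δ = ⌈n/4⌉`, some common level `a` has `P_p(High_a) ≥ g(P_p(sealed))` and
`P_p(Low_a) ≥ g(P_p(sealed))`. OPEN (p-uniform 3-D replacement of Tassion 2016 L2.1); size XL. -/
theorem stub_balancingAllP :
    ∃ g : ℝ → ℝ, Monotone g ∧ (∀ s, 0 < s → 0 < g s) ∧ ∀ (p : unitInterval) (n δ L M : ℕ), 1 ≤ n →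
      4 * δ ≤ n + 3 → n ≤ 4 * δ → n ≤ L → L ≤ 5 * n → n ≤ M → M ≤ 5 * n → ∃ a : ℕ,
        g ((bondPercolation (zdGraph 3) p).real
            {ω | ¬ ∃ x ∈ Finset.Icc (0 : Site 3) ![(n : ℤ), L, M],
              ∃ y ∈ Finset.Icc (0 : Site 3) ![(n : ℤ), L, M],
                x 0 = 0 ∧ y 0 = n ∧ ω ∈ openConnIn ↑(Finset.Icc (0 : Site 3) ![(n : ℤ), L, M]) x y}) ≤
          (bondPercolation (zdGraph 3) p).real
            {ω | ¬ ∃ x ∈ Finset.Icc (0 : Site 3) ![(n : ℤ), L, M],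
              ∃ y ∈ Finset.Icc (0 : Site 3) ![(n : ℤ), L, M],
                (x 0 = 0 ∨ (x 1 = L ∧ x 0 < a)) ∧ y 0 = n ∧
                  ω ∈ openConnIn ↑(Finset.Icc (0 : Site 3) ![(n : ℤ), L, M]) x y} ∧
        g ((bondPercolation (zdGraph 3) p).real
            {ω | ¬ ∃ x ∈ Finset.Icc (0 : Site 3) ![(n : ℤ), L, M],
              ∃ y ∈ Finset.Icc (0 : Site 3) ![(n : ℤ), L, M],
                x 0 = 0 ∧ y 0 = n ∧ ω ∈ openConnIn ↑(Finset.Icc (0 : Site 3) ![(n : ℤ), L, M]) x y}) ≤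
          (bondPercolation (zdGraph 3) p).real
            {ω | ¬ ∃ x ∈ Finset.Icc (0 : Site 3) ![(n : ℤ), L, M],
              ∃ y ∈ Finset.Icc (0 : Site 3) ![(n : ℤ), L, M],
                x 0 = 0 ∧ (y 0 = n ∨ (y 1 = δ ∧ (a : ℤ) ≤ y 0)) ∧
                  ω ∈ openConnIn ↑(Finset.Icc (0 : Site 3) ![(n : ℤ), L, M]) x y} := by
  sorry

/-- **stub 2 (registered) = `Stubs.stub_diagonalAllP` spelled out** — `TiltDiagonalAllP`: one
monotone `g > 0` on `(0,∞)` with `P_p(Diag_a) ≥ g(P_p(R(n; L, M) sealed))` for every `p`, every box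
of the family and every level `a`. For `L ≥ n + δ` provable now with `g = id` (sub-path across the
slab `δ ≤ x₁ ≤ δ + n`, isometry `x₀ ↔ x₁`, sub-box monotonicity); for `L ∈ [n, n+δ)` it is the
short-box comparison `P_p(R(L−δ; n, M) sealed) ≥ g(P_p(R(n; L, M) sealed))`; size L. -/
theorem stub_diagonalAllP :
    ∃ g : ℝ → ℝ, Monotone g ∧ (∀ s, 0 < s → 0 < g s) ∧ ∀ (p : unitInterval) (n δ L M a : ℕ), 1 ≤ n →
      4 * δ ≤ n + 3 → n ≤ 4 * δ → n ≤ L → L ≤ 5 * n → n ≤ M → M ≤ 5 * n →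
        g ((bondPercolation (zdGraph 3) p).real
            {ω | ¬ ∃ x ∈ Finset.Icc (0 : Site 3) ![(n : ℤ), L, M],
              ∃ y ∈ Finset.Icc (0 : Site 3) ![(n : ℤ), L, M],
                x 0 = 0 ∧ y 0 = n ∧ ω ∈ openConnIn ↑(Finset.Icc (0 : Site 3) ![(n : ℤ), L, M]) x y}) ≤
          (bondPercolation (zdGraph 3) p).real
            {ω | ¬ ∃ x ∈ Finset.Icc (0 : Site 3) ![(n : ℤ), L, M],
              ∃ y ∈ Finset.Icc (0 : Site 3) ![(n : ℤ), L, M],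
                (x 1 = L ∧ x 0 < a) ∧ (y 1 = δ ∧ (a : ℤ) ≤ y 0) ∧
                  ω ∈ openConnIn ↑(Finset.Icc (0 : Site 3) ![(n : ℤ), L, M]) x y} := by
  sorry

/-- **stub 3 (registered) = the sibling piece `X₂ = CubeBlockingSeed` BY NAME** (stmt-CriticalPhenomena-1141,
shared with route `PercTiltedBlockers`; it has its own registered skeleton `Cruxes/CubeBlockingSeed/Lines/birth.lean`
and MC support on the item). Listed as a stub only so that the parent composition below is a closed term; it is
discharged the moment the item closes (`PercAnnulusCrossing.CubeBlockingSeed` is then a theorem). It is strictly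
WEAKER than the parent (landed `cubeBlockingSeed_of_critAnnulusNonCrossing`, p124521) and does not give the parent
or the summit on its own (probes `bc/CubeBlockingSeed_probe*.lean`: 14/14 fail). Size: open-problem (the `d = 3`,
`q = 1`-specific hyperscaling seed; barrier `SpanningClustersAboveSix` applies verbatim). -/
theorem stub_cubeBlockingSeed :
    Summit.CriticalPhenomena.PercolationContinuityZ3.Theses.PercAnnulusCrossing.CubeBlockingSeed := by
  sorry

/-! ## Tools for the composition (all proved) -/

/-- The generic "no open path inside the finite box `R` from `{x ∈ R | Ps x}` to `{y ∈ R | Qs y}`"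
event, in the exact shape of the route's decls (adapted from `Cruxes/TiltComparison/Lines/birth.lean`). -/
def noPath (R : Finset (Site 3)) (Ps Qs : Site 3 → Prop) : Set (BondConfig (Site 3)) :=
  {ω | ¬ ∃ x ∈ R, ∃ y ∈ R, Ps x ∧ Qs y ∧ ω ∈ openConnIn (↑R : Set (Site 3)) x y}

theorem noPath_eq_compl (R : Finset (Site 3)) (Ps Qs : Site 3 → Prop) :
    noPath R Ps Qs =
      (openCrossing (↑R : Set (Site 3)) {x | x ∈ R ∧ Ps x} {y | y ∈ R ∧ Qs y})ᶜ := by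
  ext ω
  simp only [noPath, Set.mem_setOf_eq, Set.mem_compl_iff, mem_openCrossing_iff]
  exact Iff.not ⟨fun ⟨x, hx, y, hy, hP, hQ, hc⟩ => ⟨x, ⟨hx, hP⟩, y, ⟨hy, hQ⟩, hc⟩,
    fun ⟨x, ⟨hx, hP⟩, y, ⟨hy, hQ⟩, hc⟩ => ⟨x, hx, y, hy, hP, hQ, hc⟩⟩

/-- `noPath` events are decreasing. -/
theorem isLowerSet_noPath (R : Finset (Site 3)) (Ps Qs : Site 3 → Prop) :
    IsLowerSet (noPath R Ps Qs) := by
  rw [noPath_eq_compl]; exact (isUpperSet_openCrossing _ _ _).compl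

/-- `noPath` events of a finite box are measurable. -/
theorem measurableSet_noPath (R : Finset (Site 3)) (Ps Qs : Site 3 → Prop) :
    MeasurableSet (noPath R Ps Qs) := by
  rw [noPath_eq_compl]; exact (measurableSet_openCrossing _ _ _).compl

/-- Harris–FKG for three decreasing measurable events, followed by monotonicity of measure. -/
theorem real_mul_mul_le (p : unitInterval) {A B C D : Set (BondConfig (Site 3))}
    (hA : IsLowerSet A) (hB : IsLowerSet B) (hC : IsLowerSet C)
    (hAm : MeasurableSet A) (hBm : MeasurableSet B) (hCm : MeasurableSet C)
    (hsub : A ∩ B ∩ C ⊆ D) :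
    (bondPercolation (zdGraph 3) p).real A * (bondPercolation (zdGraph 3) p).real B *
        (bondPercolation (zdGraph 3) p).real C ≤ (bondPercolation (zdGraph 3) p).real D := by
  have h1 := harris_fkg_lower (zdGraph 3) p hA hB hAm hBm
  have h2 := harris_fkg_lower (zdGraph 3) p (hA.inter hB) hC (hAm.inter hBm) hCm
  have h3 : (bondPercolation (zdGraph 3) p).real (A ∩ B ∩ C) ≤
      (bondPercolation (zdGraph 3) p).real D := measureReal_mono hsub
  calc (bondPercolation (zdGraph 3) p).real A * (bondPercolation (zdGraph 3) p).real B *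
        (bondPercolation (zdGraph 3) p).real C
      ≤ (bondPercolation (zdGraph 3) p).real (A ∩ B) * (bondPercolation (zdGraph 3) p).real C :=
        mul_le_mul_of_nonneg_right h1 measureReal_nonneg
    _ ≤ (bondPercolation (zdGraph 3) p).real (A ∩ B ∩ C) := h2
    _ ≤ (bondPercolation (zdGraph 3) p).real D := h3

/-- The factorisation `High ∩ Low ∩ Diag ⊆ Tilt` (pure logic on the endpoint predicates). -/
theorem inter_subset_noPath_or (R : Finset (Site 3)) (P₁ P₂ Q₁ Q₂ : Site 3 → Prop) :
    noPath R (fun x => P₁ x ∨ P₂ x) Q₁ ∩ noPath R P₁ (fun y => Q₁ y ∨ Q₂ y) ∩ noPath R P₂ Q₂ ⊆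
      noPath R (fun x => P₁ x ∨ P₂ x) (fun y => Q₁ y ∨ Q₂ y) := by
  rintro ω ⟨⟨hH, hL⟩, hD⟩ ⟨x, hx, y, hy, hP, hQ, hc⟩
  rcases hQ with hQ | hQ
  · exact hH ⟨x, hx, y, hy, hP, hQ, hc⟩
  · rcases hP with hP | hP
    · exact hL ⟨x, hx, y, hy, hP, Or.inr hQ, hc⟩
    · exact hD ⟨x, hx, y, hy, hP, hQ, hc⟩

/-- `P(High) · P(Low) · P(Diag) ≤ P(Tilt)` for any box and any endpoint predicates, every `p`. -/
theorem tilt_lower_bound (p : unitInterval) (R : Finset (Site 3)) (P₁ P₂ Q₁ Q₂ : Site 3 → Prop) :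
    (bondPercolation (zdGraph 3) p).real (noPath R (fun x => P₁ x ∨ P₂ x) Q₁) *
        (bondPercolation (zdGraph 3) p).real (noPath R P₁ (fun y => Q₁ y ∨ Q₂ y)) *
        (bondPercolation (zdGraph 3) p).real (noPath R P₂ Q₂) ≤
      (bondPercolation (zdGraph 3) p).real
        (noPath R (fun x => P₁ x ∨ P₂ x) (fun y => Q₁ y ∨ Q₂ y)) :=
  real_mul_mul_le p (isLowerSet_noPath _ _ _) (isLowerSet_noPath _ _ _) (isLowerSet_noPath _ _ _)
    (measurableSet_noPath _ _ _) (measurableSet_noPath _ _ _) (measurableSet_noPath _ _ _)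
    (inter_subset_noPath_or R P₁ P₂ Q₁ Q₂)

/-- The arithmetic of the Harris merging. -/
theorem sq_mul_le_of_le {u w H Lo D T : ℝ} (hu : 0 ≤ u) (hw : 0 ≤ w) (hH : u ≤ H) (hL : u ≤ Lo)
    (hD : w ≤ D) (hkey : H * Lo * D ≤ T) : u ^ 2 * w ≤ T := by
  have h0H : 0 ≤ H := hu.trans hH
  have h0L : 0 ≤ Lo := hu.trans hL
  have h1 : u * u ≤ H * Lo := mul_le_mul hH hL hu h0H
  have h2 : u * u * w ≤ H * Lo * D := mul_le_mul h1 hD hw (mul_nonneg h0H h0L)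
  rw [sq]; exact h2.trans hkey

/-- The sealing probability `β_p(h; L, M) = P_p(R(h; L, M) sealed across direction 0)`, in the
exact shape of the route's decls (`BlockerRSW3D`: `q_n = B p n n n`, `w_n = B p n (2n) (2n)`). -/
def B (p : unitInterval) (h L M : ℕ) : ℝ :=
  (bondPercolation (zdGraph 3) p).real
    {ω | ¬ ∃ x ∈ Finset.Icc (0 : Site 3) ![(h : ℤ), L, M],
      ∃ y ∈ Finset.Icc (0 : Site 3) ![(h : ℤ), L, M],
        x 0 = 0 ∧ y 0 = h ∧ ω ∈ openConnIn ↑(Finset.Icc (0 : Site 3) ![(h : ℤ), L, M]) x y}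

/-- Wider cross-sections are harder to seal: `β_p(h; L', M') ≤ β_p(h; L, M)` for `L ≤ L'`,
`M ≤ M'` (an open crossing of the narrow box is an open crossing of the wide one, `openConnIn_mono`). -/
theorem B_anti (p : unitInterval) (h : ℕ) {L L' M M' : ℕ} (hL : L ≤ L') (hM : M ≤ M') :
    B p h L' M' ≤ B p h L M := by
  unfold B
  refine measureReal_mono ?_
  intro ω hω
  simp only [Set.mem_setOf_eq] at hω ⊢
  rintro ⟨x, hx, y, hy, hx0, hy0, hc⟩
  have hsub : Finset.Icc (0 : Site 3) ![(h : ℤ), (L : ℤ), (M : ℤ)] ⊆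
      Finset.Icc (0 : Site 3) ![(h : ℤ), (L' : ℤ), (M' : ℤ)] := by
    intro z hz
    rw [TiltSquaring.mem_box0] at hz ⊢
    omega
  exact hω ⟨x, hsub hx, y, hsub hy, hx0, hy0, openConnIn_mono (Finset.coe_subset.mpr hsub) x y hc⟩

/-- Swapping the two cross-section axes preserves the sealing probability (every `p`). -/
theorem B_swap (p : unitInterval) (h L M : ℕ) : B p h L M = B p h M L := by
  unfold B
  exact tilt_real_blocked_swap p (h : ℤ) (L : ℤ) (M : ℤ)

/-! ## The composition (proved): the two stubs imply the crux BY NAME -/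

/-- Step 1 (Harris merging, every `p`): the two stubs give the p-uniform tilt comparison on the
family with `G s := (max (g₁ s) 0) ^ 2 * max (g₂ s) 0`. -/
theorem tiltComparisonAllP_of (h1 : Stubs.stub_balancingAllP) (h2 : Stubs.stub_diagonalAllP) :
    ∃ G : ℝ → ℝ, Monotone G ∧ (∀ s, 0 < s → 0 < G s) ∧ (∀ s, 0 ≤ G s) ∧
      ∀ (p : unitInterval) (n δ L M : ℕ), 1 ≤ n → 4 * δ ≤ n + 3 → n ≤ 4 * δ → n ≤ L → L ≤ 5 * n →
        n ≤ M → M ≤ 5 * n → ∃ a : ℕ,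
          G (B p n L M) ≤ (bondPercolation (zdGraph 3) p).real
            {ω | ¬ ∃ x ∈ Finset.Icc (0 : Site 3) ![(n : ℤ), L, M],
              ∃ y ∈ Finset.Icc (0 : Site 3) ![(n : ℤ), L, M], (x 0 = 0 ∨ (x 1 = L ∧ x 0 < a)) ∧
                (y 0 = n ∨ (y 1 = δ ∧ (a : ℤ) ≤ y 0)) ∧
                  ω ∈ openConnIn ↑(Finset.Icc (0 : Site 3) ![(n : ℤ), L, M]) x y} := by
  unfold Stubs.stub_balancingAllP at h1
  unfold Stubs.stub_diagonalAllP at h2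
  obtain ⟨g₁, hg₁, hg₁0, H1⟩ := h1
  obtain ⟨g₂, hg₂, hg₂0, H2⟩ := h2
  refine ⟨fun s => (max (g₁ s) 0) ^ 2 * max (g₂ s) 0, ?_, ?_, ?_, ?_⟩
  · intro s t hst
    have a1 : max (g₁ s) 0 ≤ max (g₁ t) 0 := max_le_max (hg₁ hst) le_rfl
    have a2 : max (g₂ s) 0 ≤ max (g₂ t) 0 := max_le_max (hg₂ hst) le_rfl
    have b1 : (0 : ℝ) ≤ max (g₁ s) 0 := le_max_right _ _
    have b2 : (0 : ℝ) ≤ max (g₂ s) 0 := le_max_right _ _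
    exact mul_le_mul (pow_le_pow_left₀ b1 a1 2) a2 b2 (sq_nonneg _)
  · intro s hs
    have c1 : (0 : ℝ) < max (g₁ s) 0 := lt_max_of_lt_left (hg₁0 s hs)
    have c2 : (0 : ℝ) < max (g₂ s) 0 := lt_max_of_lt_left (hg₂0 s hs)
    exact mul_pos (pow_pos c1 2) c2
  · intro s
    exact mul_nonneg (sq_nonneg _) (le_max_right _ _)
  · intro p n δ L M hn hδ hδ' hL hL' hM hM'
    obtain ⟨a, haH, haL⟩ := H1 p n δ L M hn hδ hδ' hL hL' hM hM'
    have haD := H2 p n δ L M a hn hδ hδ' hL hL' hM hM'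
    refine ⟨a, ?_⟩
    have key := tilt_lower_bound p (Finset.Icc (0 : Site 3) ![(n : ℤ), L, M])
      (fun x => x 0 = 0) (fun x => x 1 = L ∧ x 0 < a)
      (fun y => y 0 = n) (fun y => y 1 = δ ∧ (a : ℤ) ≤ y 0)
    exact sq_mul_le_of_le (le_max_right _ _) (le_max_right _ _) (max_le haH measureReal_nonneg)
      (max_le haL measureReal_nonneg) (max_le haD measureReal_nonneg) key

/-- Step 2 (tilt squaring, every `p`): one widening step `φ(β_p(n; L, M)) ≤ β_p(n; L+δ, M)` on the
family, `φ s := (G s)²`, by the landed `tiltSquaring_proof` (`δ ≤ n ≤ L`). -/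
theorem widen_step {G : ℝ → ℝ} (hG0 : ∀ s, 0 ≤ G s)
    (hT : ∀ (p : unitInterval) (n δ L M : ℕ), 1 ≤ n → 4 * δ ≤ n + 3 → n ≤ 4 * δ → n ≤ L → L ≤ 5 * n →
        n ≤ M → M ≤ 5 * n → ∃ a : ℕ,
          G (B p n L M) ≤ (bondPercolation (zdGraph 3) p).real
            {ω | ¬ ∃ x ∈ Finset.Icc (0 : Site 3) ![(n : ℤ), L, M],
              ∃ y ∈ Finset.Icc (0 : Site 3) ![(n : ℤ), L, M], (x 0 = 0 ∨ (x 1 = L ∧ x 0 < a)) ∧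
                (y 0 = n ∨ (y 1 = δ ∧ (a : ℤ) ≤ y 0)) ∧
                  ω ∈ openConnIn ↑(Finset.Icc (0 : Site 3) ![(n : ℤ), L, M]) x y})
    (p : unitInterval) {n δ L M : ℕ} (hn : 1 ≤ n) (hδ : 4 * δ ≤ n + 3) (hδ' : n ≤ 4 * δ)
    (hL : n ≤ L) (hL' : L ≤ 5 * n) (hM : n ≤ M) (hM' : M ≤ 5 * n) :
    (G (B p n L M)) ^ 2 ≤ B p n (L + δ) M := by
  obtain ⟨a, ha⟩ := hT p n δ L M hn hδ hδ' hL hL' hM hM'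
  have hsq := tiltSquaring_proof p n L M δ a (by omega)
  have e : ((L + δ : ℕ) : ℤ) = (L : ℤ) + (δ : ℤ) := Nat.cast_add L δ
  unfold B
  rw [e]
  exact (pow_le_pow_left₀ (hG0 _) ha 2).trans hsq

/-- Step 3 (the walk in `L`, every `p`): `φ^[k](β_p(n; n, M)) ≤ β_p(n; n + kδ, M)` for `k ≤ 4`. -/
theorem walk {φ : ℝ → ℝ} (hφ : Monotone φ)
    (hstep : ∀ (p : unitInterval) (n δ L M : ℕ), 1 ≤ n → 4 * δ ≤ n + 3 → n ≤ 4 * δ → n ≤ L →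
      L ≤ 5 * n → n ≤ M → M ≤ 5 * n → φ (B p n L M) ≤ B p n (L + δ) M)
    (p : unitInterval) {n δ M : ℕ} (hn : 1 ≤ n) (hδ : 4 * δ ≤ n + 3) (hδ' : n ≤ 4 * δ)
    (hM : n ≤ M) (hM' : M ≤ 5 * n) :
    ∀ k, k ≤ 4 → φ^[k] (B p n n M) ≤ B p n (n + k * δ) M := by
  intro k
  induction k with
  | zero =>
    intro _
    simp only [Function.iterate_zero, id_eq, Nat.zero_mul, Nat.add_zero, le_refl]
  | succ k ih =>
    intro hk
    have hk' : k ≤ 3 := by omega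
    have h1 := ih (by omega)
    have h2 := hstep p n δ (n + k * δ) M hn hδ hδ' (by omega) (by nlinarith) hM hM'
    have e : n + k * δ + δ = n + (k + 1) * δ := by ring
    rw [Function.iterate_succ_apply', ← e]
    exact (hφ h1).trans h2

/-- **`BlockerRSW3D` from the two stubs** (hypotheses = the declared stub `Prop`s by name;
conclusion = the route decl `PercAnnulusCrossing.BlockerRSW3D` by name; no `sorry`).
Witness: `f s := min s (φ^[8] s)` with `φ s := (G s)²`, `G s := (max (g₁ s) 0)² · max (g₂ s) 0`. -/
theorem BlockerRSW3D_of (h1 : Stubs.stub_balancingAllP) (h2 : Stubs.stub_diagonalAllP) :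
    Summit.CriticalPhenomena.PercolationContinuityZ3.Theses.PercAnnulusCrossing.BlockerRSW3D := by
  obtain ⟨G, hGmono, hGpos, hG0, hT⟩ := tiltComparisonAllP_of h1 h2
  set φ : ℝ → ℝ := fun s => (G s) ^ 2 with hφdef
  have hφmono : Monotone φ := fun s t hst => pow_le_pow_left₀ (hG0 s) (hGmono hst) 2
  have hφpos : ∀ s, 0 < s → 0 < φ s := fun s hs => pow_pos (hGpos s hs) 2
  have hstep : ∀ (p : unitInterval) (n δ L M : ℕ), 1 ≤ n → 4 * δ ≤ n + 3 → n ≤ 4 * δ → n ≤ L →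
      L ≤ 5 * n → n ≤ M → M ≤ 5 * n → φ (B p n L M) ≤ B p n (L + δ) M :=
    fun p n δ L M hn hδ hδ' hL hL' hM hM' => widen_step hG0 hT p hn hδ hδ' hL hL' hM hM'
  have hiter_mono : ∀ k, Monotone (φ^[k]) := fun k => hφmono.iterate k
  have hiter_pos : ∀ k s, 0 < s → 0 < φ^[k] s := by
    intro k
    induction k with
    | zero => intro s hs; simpa using hs
    | succ k ih => intro s hs; rw [Function.iterate_succ_apply']; exact hφpos _ (ih s hs)
  -- the p-uniform bound `φ^[8] (q_n(p)) ≤ w_n(p)`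
  have main : ∀ (p : unitInterval) (n : ℕ), 1 ≤ n → φ^[8] (B p n n n) ≤ B p n (2 * n) (2 * n) := by
    intro p n hn
    -- the shift `δ = ⌈n/4⌉`
    set δ : ℕ := (n + 3) / 4 with hδdef
    have hδ : 4 * δ ≤ n + 3 := by omega
    have hδ' : n ≤ 4 * δ := by omega
    -- first walk: `L = n → n + 4δ` at `M = n`
    have w1 : φ^[4] (B p n n n) ≤ B p n (n + 4 * δ) n :=
      walk hφmono hstep p hn hδ hδ' le_rfl (by omega) 4 le_rfl
    -- swap the cross-section axes
    rw [B_swap p n (n + 4 * δ) n] at w1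
    -- second walk: `L = n → n + 4δ` at `M = n + 4δ`
    have w2 : φ^[4] (B p n n (n + 4 * δ)) ≤ B p n (n + 4 * δ) (n + 4 * δ) :=
      walk hφmono hstep p hn hδ hδ' (by omega) (by omega) 4 le_rfl
    -- combine and shrink the cross-section back to `2n × 2n`
    have w3 : φ^[8] (B p n n n) ≤ B p n (n + 4 * δ) (n + 4 * δ) := by
      rw [show (8 : ℕ) = 4 + 4 from rfl, Function.iterate_add_apply]
      exact (hiter_mono 4 w1).trans w2
    exact w3.trans (B_anti p n (by omega) (by omega))
  -- the witness
  refine ⟨fun s => min s (φ^[8] s), ?_, ?_, ?_⟩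
  · exact monotone_id.min (hiter_mono 8)
  · intro s hs
    exact lt_min hs (hiter_pos 8 s hs)
  · intro p n hn
    have e2 : ((2 * n : ℕ) : ℤ) = 2 * (n : ℤ) := by push_cast; ring
    have h := main p n hn
    simp only [B, e2] at h
    exact (min_le_right _ _).trans h

/-- **The skeleton IS the crux proof** (D-0027 §3.3): `BlockerRSW3D` from the two registered
stubs; sorry-free as soon as `stub_balancingAllP` and `stub_diagonalAllP` are discharged. -/
theorem BlockerRSW3D_proof :
    Summit.CriticalPhenomena.PercolationContinuityZ3.Theses.PercAnnulusCrossing.BlockerRSW3D :=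
  BlockerRSW3D_of stub_balancingAllP stub_diagonalAllP

/-- **The parent from the three stubs** (BC2 redirect, assembly = the LANDED
`StubBlockerRSWGlue.critAnnulusNonCrossing_of`, p121157): `CritAnnulusNonCrossing` BY NAME from
`stub_balancingAllP`, `stub_diagonalAllP` (⟹ `BlockerRSW3D`) and `CubeBlockingSeed`. No `sorry`. -/
theorem CritAnnulusNonCrossing_of (h1 : Stubs.stub_balancingAllP) (h2 : Stubs.stub_diagonalAllP)
    (h3 : Summit.CriticalPhenomena.PercolationContinuityZ3.Theses.PercAnnulusCrossing.CubeBlockingSeed) :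
    Summit.CriticalPhenomena.PercolationContinuityZ3.Theses.PercAnnulusCrossing.CritAnnulusNonCrossing :=
  Summit.CriticalPhenomena.PercolationContinuityZ3.Theorems.SubpolynomialBlocking.StubBlockerRSWGlue.critAnnulusNonCrossing_of
    (BlockerRSW3D_of h1 h2) h3

/-- **The skeleton IS the parent's proof**: `CritAnnulusNonCrossing` from the three registered stubs;
sorry-free as soon as `stub_balancingAllP`, `stub_diagonalAllP` and the item `CubeBlockingSeed` are in. -/
theorem CritAnnulusNonCrossing_proof :
    Summit.CriticalPhenomena.PercolationContinuityZ3.Theses.PercAnnulusCrossing.CritAnnulusNonCrossing :=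
  CritAnnulusNonCrossing_of stub_balancingAllP stub_diagonalAllP stub_cubeBlockingSeed

/-- And the sub-problem Statement through the route's deciding theorem (`closes`, with the PROVED item
`CrossingTendstoOne`, `Theorems.crossingTendstoOne_proof`). -/
theorem percolationContinuityZ3_of (h1 : Stubs.stub_balancingAllP) (h2 : Stubs.stub_diagonalAllP)
    (h3 : Summit.CriticalPhenomena.PercolationContinuityZ3.Theses.PercAnnulusCrossing.CubeBlockingSeed)
    (h5 : Summit.CriticalPhenomena.PercolationContinuityZ3.Theses.PercAnnulusCrossing.CrossingTendstoOne) :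
    _root_.PercolationContinuityZ3 :=
  -- buildfix 2026-08-19: after the BC2 redirect the route's `closes` takes the pieces
  -- `(h₁ : BlockerRSW3D) (h₂ : CubeBlockingSeed) (h₃ : BlockerRSWGlue) (h₅ : CrossingTendstoOne)` and derives
  -- `CritAnnulusNonCrossing` itself; the glue binder is the LANDED `stub_blockerRSWGlue` (p121157, verbatim body).
  Summit.CriticalPhenomena.PercolationContinuityZ3.Theses.PercAnnulusCrossing.closes
    (BlockerRSW3D_of h1 h2) h3
    Summit.CriticalPhenomena.PercolationContinuityZ3.Theorems.SubpolynomialBlocking.stub_blockerRSWGlue h5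

end Summit.CriticalPhenomena.PercolationContinuityZ3.Cruxes.CritAnnulusNonCrossing.BlockerTiltAllP

end
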